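import Summits.NavierStokesRegularity.NavierStokesRegularity.Theorems.ExtremiserTransienceTwoThirdsLayerPointwise
import HarnessLib

/-!
# Route `ExtremiserTransience`, crux `NearExtremalTransiencePerFlow` (stmt-NavierStokesRegularity-26567),
# LINE g10-1 «two_thirds» (ns-idea-10), stub S1a′ — BRICK 2, lemma P3a: POINTWISE STRUCTURE OF THE PIECE FIELD `φ = curl(χψ)`

`--supports stmt-NavierStokesRegularity-26567` (helper; prover seat ns-net-p2 g13; design = evidence #59 on ⟨26567⟩ and HOME
`g12-netp2-S1a-brime-pipeline.md`).  The localised sharp inequality of S1a′ applies κ⋆-universality to the piece field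
`φ = curl(χψ)` of a field `w` in its local Coulomb gauge `ψ` (`curl ψ = w − G` with a remainder `G` that is CURL-FREE on an open set
`T ⊇ tsupport χ`; in the application `ψ = K∗(ζw)`, `G = (1−ζ)w + ∇Π`, `T = B(c, 2s)`, files `…TwoThirdsGaugePointwise`, `…TwoThirdsPieceField`).
This file is the pure calculus of that field — for ARBITRARY smooth `w ψ G χ` with `curl ψ = w − G`:

* `piece_eq` — `φ = χ•w − χ•G + curlCLM(Dχ ⊗ ψ)` (Leibniz, `curl_smul`);  `norm_piece_le`;
* `smul_curl_eventuallyEq_zero` — `χ•curl G` vanishes near every point when `curl G = 0` on an open `T ⊇ tsupport χ`;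
* `curl_piece_sub_eq`, `norm_curl_piece_sub_le` — the ENSTROPHY OFFSET `curl φ − χ•curl w = curlCLM(Dχ ⊗ w) − curlCLM(Dχ ⊗ G) + curl(curlCLM(Dχ ⊗ ψ))`
  (no `curl G`, no second derivative of `G`), and its norm `≤ c‖Dχ‖(‖w‖ + ‖G‖) + c²(‖D²χ‖‖ψ‖ + ‖Dχ‖‖Dψ‖)`, `c = ‖curlCLM‖`;
* `fderiv_curl_piece_sub_eq`, `norm_fderiv_curl_piece_sub_le` — the PALINSTROPHY OFFSET `D(curl φ) − χ•D(curl w)` and its norm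
  `≤ ‖Dχ‖‖curl w‖ + c(‖D²χ‖‖w‖ + ‖Dχ‖‖Dw‖) + c(‖D²χ‖‖G‖ + ‖Dχ‖‖DG‖) + c²(‖D³χ‖‖ψ‖ + 2‖D²χ‖‖Dψ‖ + ‖Dχ‖‖D²ψ‖)`;
* `fderiv_piece_sub_eq`, `norm_fderiv_piece_sub_le` — the GRADIENT OFFSET `Dφ − χ•Dw = Dχ ⊗ w − χ•DG − Dχ ⊗ G + D(curlCLM(Dχ ⊗ ψ))`
  and its norm `≤ ‖Dχ‖‖w‖ + |χ|‖DG‖ + ‖Dχ‖‖G‖ + c(‖D²χ‖‖ψ‖ + ‖Dχ‖‖Dψ‖)`.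
Every offset carries a derivative of `χ` (size `ℓ⁻¹ = s^{-7/8}` on the thin layer) or `DG` (size `s⁻²`), which is what makes the piece's
`J, Z, W` agree with `J_B, Z_B, W_B` up to layer bulk and gauge junk (P3b–P4).  Rank-one curl calculus from `…TwoThirdsRemainderCurlFree` /
`…TwoThirdsLayerPointwise` (ns-net-p1).  HONEST FRAMING: vector calculus; nothing about Navier–Stokes is proved; no summit is proved by a line. [folklore]
-/

noncomputable section

open scoped Topology InnerProductSpace RealInnerProductSpace ENNReal ContDiff
open MeasureTheory Filter Set Metric
open Literature.Analysis.FluidPDE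
open Summit.NavierStokesRegularity.NavierStokesRegularity.Theorems.DepletionLadder.KStar.HalfSpace
open Summit.NavierStokesRegularity.NavierStokesRegularity.Theorems.DepletionLadder
open Summit.NavierStokesRegularity.NavierStokesRegularity.Theorems.NearExtremalTransiencePerFlow.LocalMaximiser

namespace Summit.NavierStokesRegularity.NavierStokesRegularity.Theorems.NearExtremalTransiencePerFlow.TwoThirds

-- the summit's namespace repeats the problem name by convention (D-0017)
set_option linter.dupNamespace false

section PiecePointwise

variable {w ψ G : E3 → E3} {χ : E3 → ℝ}

/-! ## The piece field and its height -/

/-- **The piece field**: `curl(χψ) = χ•w − χ•G + curlCLM(Dχ ⊗ ψ)` when `curl ψ = w − G`. [folklore] -/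
theorem piece_eq (hχ : ContDiff ℝ (⊤ : ℕ∞) χ) (hψ : ContDiff ℝ (⊤ : ℕ∞) ψ) (hcurl : ∀ x, curl ψ x = w x - G x) :
    curl (fun y => χ y • ψ y) = fun x => χ x • w x - χ x • G x + curlCLM ((fderiv ℝ χ x).smulRight (ψ x)) := by
  have hχd : Differentiable ℝ χ := hχ.differentiable (by simp)
  have hψd : Differentiable ℝ ψ := hψ.differentiable (by simp)
  funext x
  rw [curl_smul (hχd x) (hψd x), hcurl x, smul_sub]

/-- **Height of the piece**: `‖curl(χψ) x‖ ≤ |χ x|‖w x‖ + |χ x|‖G x‖ + c‖Dχ x‖‖ψ x‖`. [folklore] -/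
theorem norm_piece_le (hχ : ContDiff ℝ (⊤ : ℕ∞) χ) (hψ : ContDiff ℝ (⊤ : ℕ∞) ψ) (hcurl : ∀ x, curl ψ x = w x - G x) (x : E3) :
    ‖curl (fun y => χ y • ψ y) x‖ ≤ |χ x| * ‖w x‖ + |χ x| * ‖G x‖ + ‖curlCLM‖ * ‖fderiv ℝ χ x‖ * ‖ψ x‖ := by
  rw [piece_eq hχ hψ hcurl]
  calc ‖χ x • w x - χ x • G x + curlCLM ((fderiv ℝ χ x).smulRight (ψ x))‖
      ≤ ‖χ x • w x‖ + ‖χ x • G x‖ + ‖curlCLM ((fderiv ℝ χ x).smulRight (ψ x))‖ :=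
        (norm_add_le _ _).trans (add_le_add (norm_sub_le _ _) le_rfl)
    _ ≤ |χ x| * ‖w x‖ + |χ x| * ‖G x‖ + ‖curlCLM‖ * ‖fderiv ℝ χ x‖ * ‖ψ x‖ := by
        rw [norm_smul, norm_smul, Real.norm_eq_abs]
        exact add_le_add le_rfl (norm_rankOneCurl_le χ ψ x)

/-! ## The curl-free remainder does not see `χ` -/

/-- If `curl G = 0` on an open set `T ⊇ tsupport χ`, then `χ • curl G` vanishes near every point. [folklore] -/
theorem smul_curl_eventuallyEq_zero {T : Set E3} (hT : IsOpen T) (hχT : tsupport χ ⊆ T) (hG0 : ∀ x ∈ T, curl G x = 0) (x : E3) :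
    (fun y => χ y • curl G y) =ᶠ[𝓝 x] fun _ => (0 : E3) := by
  by_cases hx : x ∈ T
  · filter_upwards [hT.mem_nhds hx] with y hy
    rw [hG0 y hy, smul_zero]
  · have hx' : x ∉ tsupport χ := fun h => hx (hχT h)
    have hev : χ =ᶠ[𝓝 x] 0 := by
      rw [← notMem_tsupport_iff_eventuallyEq]
      exact hx'
    filter_upwards [hev] with y hy
    rw [hy, Pi.zero_apply, zero_smul]

/-- Under the same hypothesis `χ x • curl G x = 0` at every point. [folklore] -/
theorem smul_curl_eq_zero {T : Set E3} (hT : IsOpen T) (hχT : tsupport χ ⊆ T) (hG0 : ∀ x ∈ T, curl G x = 0) (x : E3) :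
    χ x • curl G x = 0 :=
  (smul_curl_eventuallyEq_zero hT hχT hG0 x).eq_of_nhds

/-- … and `Dχ x ⊗ curl G x = 0` at every point. [folklore] -/
theorem smulRight_curl_eq_zero {T : Set E3} (hχT : tsupport χ ⊆ T) (hG0 : ∀ x ∈ T, curl G x = 0) (x : E3) :
    (fderiv ℝ χ x).smulRight (curl G x) = 0 := by
  by_cases hx : x ∈ T
  · rw [hG0 x hx, ContinuousLinearMap.smulRight_zero]
  · have hx' : x ∉ tsupport χ := fun h => hx (hχT h)
    rw [fderiv_of_notMem_tsupport ℝ hx', ContinuousLinearMap.zero_smulRight]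

/-! ## The enstrophy offset `curl φ − χ•curl w` -/

/-- **Enstrophy offset**: `curl(curl(χψ)) x − χ x • curl w x = curlCLM(Dχ ⊗ w) − curlCLM(Dχ ⊗ G) + curl(curlCLM(Dχ ⊗ ψ)) x`
when `curl ψ = w − G` and `curl G = 0` on an open `T ⊇ tsupport χ`. [folklore] -/
theorem curl_piece_sub_eq (hw : ContDiff ℝ (⊤ : ℕ∞) w) (hψ : ContDiff ℝ (⊤ : ℕ∞) ψ) (hG : ContDiff ℝ (⊤ : ℕ∞) G)
    (hχ : ContDiff ℝ (⊤ : ℕ∞) χ) (hcurl : ∀ x, curl ψ x = w x - G x)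
    {T : Set E3} (hT : IsOpen T) (hχT : tsupport χ ⊆ T) (hG0 : ∀ x ∈ T, curl G x = 0) (x : E3) :
    curl (curl fun y => χ y • ψ y) x - χ x • curl w x =
      curlCLM ((fderiv ℝ χ x).smulRight (w x)) - curlCLM ((fderiv ℝ χ x).smulRight (G x)) +
        curl (fun y => curlCLM ((fderiv ℝ χ y).smulRight (ψ y))) x := by
  have hχd : Differentiable ℝ χ := hχ.differentiable (by simp)
  have hwd : Differentiable ℝ w := hw.differentiable (by simp)
  have hGd : Differentiable ℝ G := hG.differentiable (by simp)
  have hΞd : Differentiable ℝ fun y => curlCLM ((fderiv ℝ χ y).smulRight (ψ y)) :=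
    (contDiff_rankOneCurl hχ hψ).differentiable (by simp)
  have h1 : DifferentiableAt ℝ (fun y => χ y • w y) x := (hχd x).smul (hwd x)
  have h2 : DifferentiableAt ℝ (fun y => χ y • G y) x := (hχd x).smul (hGd x)
  have h12 : DifferentiableAt ℝ (fun y => χ y • w y - χ y • G y) x := h1.sub h2
  rw [piece_eq hχ hψ hcurl, curl_add h12 (hΞd x), curl_sub h1 h2, curl_smul (hχd x) (hwd x), curl_smul (hχd x) (hGd x),
    smul_curl_eq_zero hT hχT hG0 x, zero_add]
  abel

/-- **Size of the enstrophy offset**: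
`‖curl φ x − χ x • curl w x‖ ≤ c‖Dχ‖‖w‖ + c‖Dχ‖‖G‖ + c²(‖D²χ‖‖ψ‖ + ‖Dχ‖‖Dψ‖)`, `c = ‖curlCLM‖`. [folklore] -/
theorem norm_curl_piece_sub_le (hw : ContDiff ℝ (⊤ : ℕ∞) w) (hψ : ContDiff ℝ (⊤ : ℕ∞) ψ) (hG : ContDiff ℝ (⊤ : ℕ∞) G)
    (hχ : ContDiff ℝ (⊤ : ℕ∞) χ) (hcurl : ∀ x, curl ψ x = w x - G x)
    {T : Set E3} (hT : IsOpen T) (hχT : tsupport χ ⊆ T) (hG0 : ∀ x ∈ T, curl G x = 0) (x : E3) :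
    ‖curl (curl fun y => χ y • ψ y) x - χ x • curl w x‖ ≤
      ‖curlCLM‖ * ‖fderiv ℝ χ x‖ * ‖w x‖ + ‖curlCLM‖ * ‖fderiv ℝ χ x‖ * ‖G x‖ +
        ‖curlCLM‖ * (‖curlCLM‖ * (‖iteratedFDeriv ℝ 2 χ x‖ * ‖ψ x‖ + ‖fderiv ℝ χ x‖ * ‖fderiv ℝ ψ x‖)) := by
  rw [curl_piece_sub_eq hw hψ hG hχ hcurl hT hχT hG0 x]
  calc ‖curlCLM ((fderiv ℝ χ x).smulRight (w x)) - curlCLM ((fderiv ℝ χ x).smulRight (G x)) +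
        curl (fun y => curlCLM ((fderiv ℝ χ y).smulRight (ψ y))) x‖
      ≤ ‖curlCLM ((fderiv ℝ χ x).smulRight (w x))‖ + ‖curlCLM ((fderiv ℝ χ x).smulRight (G x))‖ +
        ‖curl (fun y => curlCLM ((fderiv ℝ χ y).smulRight (ψ y))) x‖ :=
        (norm_add_le _ _).trans (add_le_add (norm_sub_le _ _) le_rfl)
    _ ≤ _ := by
        refine add_le_add (add_le_add (norm_rankOneCurl_le χ w x) (norm_rankOneCurl_le χ G x)) ?_
        exact (norm_curl_le _ x).trans (mul_le_mul_of_nonneg_left (norm_fderiv_rankOneCurl_le hχ hψ x) (norm_nonneg curlCLM))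

/-! ## The palinstrophy offset `D(curl φ) − χ•D(curl w)` -/

/-- `curl φ` as a function: `curl(curl(χψ)) = χ•curl w + curlCLM(Dχ ⊗ w) − curlCLM(Dχ ⊗ G) + curl(curlCLM(Dχ ⊗ ψ))`. [folklore] -/
theorem curl_piece_eq (hw : ContDiff ℝ (⊤ : ℕ∞) w) (hψ : ContDiff ℝ (⊤ : ℕ∞) ψ) (hG : ContDiff ℝ (⊤ : ℕ∞) G)
    (hχ : ContDiff ℝ (⊤ : ℕ∞) χ) (hcurl : ∀ x, curl ψ x = w x - G x)
    {T : Set E3} (hT : IsOpen T) (hχT : tsupport χ ⊆ T) (hG0 : ∀ x ∈ T, curl G x = 0) :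
    curl (curl fun y => χ y • ψ y) = fun x => χ x • curl w x +
      (curlCLM ((fderiv ℝ χ x).smulRight (w x)) - curlCLM ((fderiv ℝ χ x).smulRight (G x)) +
        curl (fun y => curlCLM ((fderiv ℝ χ y).smulRight (ψ y))) x) := by
  funext x
  rw [← curl_piece_sub_eq hw hψ hG hχ hcurl hT hχT hG0 x]
  abel

/-- **Palinstrophy offset**: `D(curl φ) x − χ x • D(curl w) x = Dχ ⊗ curl w + D(curlCLM(Dχ ⊗ w)) − D(curlCLM(Dχ ⊗ G)) + D(curl(curlCLM(Dχ ⊗ ψ)))`. [folklore] -/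
theorem fderiv_curl_piece_sub_eq (hw : ContDiff ℝ (⊤ : ℕ∞) w) (hψ : ContDiff ℝ (⊤ : ℕ∞) ψ) (hG : ContDiff ℝ (⊤ : ℕ∞) G)
    (hχ : ContDiff ℝ (⊤ : ℕ∞) χ) (hcurl : ∀ x, curl ψ x = w x - G x)
    {T : Set E3} (hT : IsOpen T) (hχT : tsupport χ ⊆ T) (hG0 : ∀ x ∈ T, curl G x = 0) (x : E3) :
    fderiv ℝ (curl (curl fun y => χ y • ψ y)) x - χ x • fderiv ℝ (curl w) x =
      (fderiv ℝ χ x).smulRight (curl w x) + fderiv ℝ (fun y => curlCLM ((fderiv ℝ χ y).smulRight (w y))) x -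
        fderiv ℝ (fun y => curlCLM ((fderiv ℝ χ y).smulRight (G y))) x +
        fderiv ℝ (curl fun y => curlCLM ((fderiv ℝ χ y).smulRight (ψ y))) x := by
  have hχd : Differentiable ℝ χ := hχ.differentiable (by simp)
  have hω : ContDiff ℝ (⊤ : ℕ∞) (curl w) := contDiff_curl (n := ⊤) hw
  have hωd : Differentiable ℝ (curl w) := hω.differentiable (by simp)
  have hΞw : Differentiable ℝ fun y => curlCLM ((fderiv ℝ χ y).smulRight (w y)) :=
    (contDiff_rankOneCurl hχ hw).differentiable (by simp)
  have hΞG : Differentiable ℝ fun y => curlCLM ((fderiv ℝ χ y).smulRight (G y)) :=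
    (contDiff_rankOneCurl hχ hG).differentiable (by simp)
  have hcΞψ : Differentiable ℝ (curl fun y => curlCLM ((fderiv ℝ χ y).smulRight (ψ y))) :=
    (contDiff_curl (n := ⊤) (contDiff_rankOneCurl hχ hψ)).differentiable (by simp)
  rw [curl_piece_eq hw hψ hG hχ hcurl hT hχT hG0]
  have h0 : DifferentiableAt ℝ (fun y => χ y • curl w y) x := (hχd x).smul (hωd x)
  have h1 : DifferentiableAt ℝ (fun y => curlCLM ((fderiv ℝ χ y).smulRight (w y)) - curlCLM ((fderiv ℝ χ y).smulRight (G y))) x :=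
    (hΞw x).sub (hΞG x)
  have h2 : DifferentiableAt ℝ (fun y => curlCLM ((fderiv ℝ χ y).smulRight (w y)) - curlCLM ((fderiv ℝ χ y).smulRight (G y)) +
      curl (fun y => curlCLM ((fderiv ℝ χ y).smulRight (ψ y))) y) x := h1.add (hcΞψ x)
  rw [fderiv_fun_add h0 h2, fderiv_fun_add h1 (hcΞψ x), fderiv_fun_sub (hΞw x) (hΞG x), fderiv_fun_smul (hχd x) (hωd x)]
  abel

/-- **Size of the palinstrophy offset**: `‖D(curl φ) x − χ x • D(curl w) x‖ ≤ ‖Dχ‖‖curl w‖ + c(‖D²χ‖‖w‖ + ‖Dχ‖‖Dw‖)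
+ c(‖D²χ‖‖G‖ + ‖Dχ‖‖DG‖) + c²(‖D³χ‖‖ψ‖ + 2‖D²χ‖‖Dψ‖ + ‖Dχ‖‖D²ψ‖)`. [folklore] -/
theorem norm_fderiv_curl_piece_sub_le (hw : ContDiff ℝ (⊤ : ℕ∞) w) (hψ : ContDiff ℝ (⊤ : ℕ∞) ψ) (hG : ContDiff ℝ (⊤ : ℕ∞) G)
    (hχ : ContDiff ℝ (⊤ : ℕ∞) χ) (hcurl : ∀ x, curl ψ x = w x - G x)
    {T : Set E3} (hT : IsOpen T) (hχT : tsupport χ ⊆ T) (hG0 : ∀ x ∈ T, curl G x = 0) (x : E3) :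
    ‖fderiv ℝ (curl (curl fun y => χ y • ψ y)) x - χ x • fderiv ℝ (curl w) x‖ ≤
      ‖fderiv ℝ χ x‖ * ‖curl w x‖ +
        ‖curlCLM‖ * (‖iteratedFDeriv ℝ 2 χ x‖ * ‖w x‖ + ‖fderiv ℝ χ x‖ * ‖fderiv ℝ w x‖) +
        ‖curlCLM‖ * (‖iteratedFDeriv ℝ 2 χ x‖ * ‖G x‖ + ‖fderiv ℝ χ x‖ * ‖fderiv ℝ G x‖) +
        ‖curlCLM‖ * (‖curlCLM‖ * (‖iteratedFDeriv ℝ 3 χ x‖ * ‖ψ x‖ + 2 * ‖iteratedFDeriv ℝ 2 χ x‖ * ‖fderiv ℝ ψ x‖ +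
          ‖fderiv ℝ χ x‖ * ‖iteratedFDeriv ℝ 2 ψ x‖)) := by
  have hΞψ : ContDiff ℝ (⊤ : ℕ∞) fun y => curlCLM ((fderiv ℝ χ y).smulRight (ψ y)) := contDiff_rankOneCurl hχ hψ
  rw [fderiv_curl_piece_sub_eq hw hψ hG hχ hcurl hT hχT hG0 x]
  calc ‖(fderiv ℝ χ x).smulRight (curl w x) + fderiv ℝ (fun y => curlCLM ((fderiv ℝ χ y).smulRight (w y))) x -
        fderiv ℝ (fun y => curlCLM ((fderiv ℝ χ y).smulRight (G y))) x +
        fderiv ℝ (curl fun y => curlCLM ((fderiv ℝ χ y).smulRight (ψ y))) x‖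
      ≤ ‖(fderiv ℝ χ x).smulRight (curl w x)‖ + ‖fderiv ℝ (fun y => curlCLM ((fderiv ℝ χ y).smulRight (w y))) x‖ +
        ‖fderiv ℝ (fun y => curlCLM ((fderiv ℝ χ y).smulRight (G y))) x‖ +
        ‖fderiv ℝ (curl fun y => curlCLM ((fderiv ℝ χ y).smulRight (ψ y))) x‖ := by
        refine (norm_add_le _ _).trans (add_le_add ((norm_sub_le _ _).trans (add_le_add (norm_add_le _ _) le_rfl)) le_rfl)
    _ ≤ _ := by
        rw [ContinuousLinearMap.norm_smulRight_apply]
        refine add_le_add (add_le_add (add_le_add le_rfl (norm_fderiv_rankOneCurl_le hχ hw x)) (norm_fderiv_rankOneCurl_le hχ hG x)) ?_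
        exact (norm_fderiv_curl_le hΞψ x).trans
          (mul_le_mul_of_nonneg_left (norm_iteratedFDeriv_two_rankOneCurl_le hχ hψ x) (norm_nonneg curlCLM))

/-! ## The gradient offset `Dφ − χ•Dw` -/

/-- **Gradient offset**: `D(curl(χψ)) x − χ x • Dw x = Dχ ⊗ w − (χ•DG + Dχ ⊗ G) + D(curlCLM(Dχ ⊗ ψ))`. [folklore] -/
theorem fderiv_piece_sub_eq (hw : ContDiff ℝ (⊤ : ℕ∞) w) (hψ : ContDiff ℝ (⊤ : ℕ∞) ψ) (hG : ContDiff ℝ (⊤ : ℕ∞) G)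
    (hχ : ContDiff ℝ (⊤ : ℕ∞) χ) (hcurl : ∀ x, curl ψ x = w x - G x) (x : E3) :
    fderiv ℝ (curl fun y => χ y • ψ y) x - χ x • fderiv ℝ w x =
      (fderiv ℝ χ x).smulRight (w x) - (χ x • fderiv ℝ G x + (fderiv ℝ χ x).smulRight (G x)) +
        fderiv ℝ (fun y => curlCLM ((fderiv ℝ χ y).smulRight (ψ y))) x := by
  have hχd : Differentiable ℝ χ := hχ.differentiable (by simp)
  have hwd : Differentiable ℝ w := hw.differentiable (by simp)
  have hGd : Differentiable ℝ G := hG.differentiable (by simp)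
  have hΞd : Differentiable ℝ fun y => curlCLM ((fderiv ℝ χ y).smulRight (ψ y)) :=
    (contDiff_rankOneCurl hχ hψ).differentiable (by simp)
  have h1 : DifferentiableAt ℝ (fun y => χ y • w y) x := (hχd x).smul (hwd x)
  have h2 : DifferentiableAt ℝ (fun y => χ y • G y) x := (hχd x).smul (hGd x)
  have h12 : DifferentiableAt ℝ (fun y => χ y • w y - χ y • G y) x := h1.sub h2
  rw [piece_eq hχ hψ hcurl, fderiv_fun_add h12 (hΞd x), fderiv_fun_sub h1 h2, fderiv_fun_smul (hχd x) (hwd x),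
    fderiv_fun_smul (hχd x) (hGd x)]
  abel

/-- **Size of the gradient offset**: `‖D(curl(χψ)) x − χ x • Dw x‖ ≤ ‖Dχ‖‖w‖ + |χ|‖DG‖ + ‖Dχ‖‖G‖ + c(‖D²χ‖‖ψ‖ + ‖Dχ‖‖Dψ‖)`. [folklore] -/
theorem norm_fderiv_piece_sub_le (hw : ContDiff ℝ (⊤ : ℕ∞) w) (hψ : ContDiff ℝ (⊤ : ℕ∞) ψ) (hG : ContDiff ℝ (⊤ : ℕ∞) G)
    (hχ : ContDiff ℝ (⊤ : ℕ∞) χ) (hcurl : ∀ x, curl ψ x = w x - G x) (x : E3) :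
    ‖fderiv ℝ (curl fun y => χ y • ψ y) x - χ x • fderiv ℝ w x‖ ≤
      ‖fderiv ℝ χ x‖ * ‖w x‖ + (|χ x| * ‖fderiv ℝ G x‖ + ‖fderiv ℝ χ x‖ * ‖G x‖) +
        ‖curlCLM‖ * (‖iteratedFDeriv ℝ 2 χ x‖ * ‖ψ x‖ + ‖fderiv ℝ χ x‖ * ‖fderiv ℝ ψ x‖) := by
  rw [fderiv_piece_sub_eq hw hψ hG hχ hcurl x]
  calc ‖(fderiv ℝ χ x).smulRight (w x) - (χ x • fderiv ℝ G x + (fderiv ℝ χ x).smulRight (G x)) +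
        fderiv ℝ (fun y => curlCLM ((fderiv ℝ χ y).smulRight (ψ y))) x‖
      ≤ ‖(fderiv ℝ χ x).smulRight (w x)‖ + ‖χ x • fderiv ℝ G x + (fderiv ℝ χ x).smulRight (G x)‖ +
        ‖fderiv ℝ (fun y => curlCLM ((fderiv ℝ χ y).smulRight (ψ y))) x‖ :=
        (norm_add_le _ _).trans (add_le_add (norm_sub_le _ _) le_rfl)
    _ ≤ _ := by
        refine add_le_add (add_le_add ?_ ((norm_add_le _ _).trans ?_)) (norm_fderiv_rankOneCurl_le hχ hψ x)
        · rw [ContinuousLinearMap.norm_smulRight_apply]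
        · rw [norm_smul, Real.norm_eq_abs, ContinuousLinearMap.norm_smulRight_apply]

end PiecePointwise

end Summit.NavierStokesRegularity.NavierStokesRegularity.Theorems.NearExtremalTransiencePerFlow.TwoThirds

end
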